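import Summits.Ventures.PercRepro.Night2ExcessMassIndep

/-!
# PercRepro — the count assembly under «no saturated middle target» (night-2, gen 24)

The count assembly of gen 21 (`localShadowHall_excess_of_count`) rests on the bases-only regime `0 ≤ cPrimeDGP`
(with the partial-spread hypothesis): the big thin members (`|B ∖ K| ≥ ρ`) are lossless because their covering sets
are middle targets whose layer-1 request `L1 ≤ (ρ − 2)·Φ/(m₁ + d)` never exceeds the capacity.  In the `(7, 5)` cells
`(3, 2)`, `(2, 1)`, `(2, 0)` that constant is negative, but the SAME conclusion holds whenever no middle target is
actually oversubscribed — a structural property of the flat.  This module re-derives the chain from that hypothesis: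

* `loss_eq_zero_of_unsat`, `loss_eq_zero_of_card_ge_unsat`: a big thin member loses nothing at an unsaturated
  covering set; `card_sdiff_add_one_eq_of_rhoL_ne_zero_unsat`: a loss pair with positive weight is a basis member;
* **`pi2Mass_le_excess_unsat`**: `pi2Mass S ≤ #coverBases(S) · E/(2^{n−ρ} − 1)`;
* **`localShadowHall_excess_of_count_unsat`**: (LI_G) from the count sum with ANY lower bound `c″ ≥ 0` on the residual
  capacity `cap2` of the middle targets.
-/

namespace PercRepro.Shadow

open Finset PerFlat ThmH

variable {α : Type*} [DecidableEq α] {M : Matroid α} [M.Finite]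

/-- A thin member loses nothing at an unsaturated covering set. -/
theorem loss_eq_zero_of_unsat {q : ℕ} {G B : Finset α} {z : α}
    (hL : L1 M q G (insert z B) ≤ capS M q G (insert z B)) : loss M q G B z = 0 := by
  unfold loss fS
  rw [if_pos hL]
  ring

/-- **A big thin member (`|B ∖ K| ≥ ρ`) loses nothing when no middle target is saturated.** -/
theorem loss_eq_zero_of_card_ge_unsat {q ρ : ℕ} {G : Finset α} (hG : G ∈ flatsQ M (q + 1))
    (hd' : (gr M \ G).card ≤ q)
    (hns : ∀ S ∈ shadowAt M (q + 2) q (Uq M (q + 2) q) G, ρ + 1 ≤ (S \ coloops M G).card →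
      L1 M q G S ≤ capS M q G S)
    {B : Finset α} (hB : B ∈ thinMembers M q G) (hcard : ρ ≤ (B \ coloops M G).card) {z : α}
    (hz : z ∈ G \ clF M B) : loss M q G B z = 0 := by
  have hSsh := insert_mem_shadowAt_thin hG hB hz
  have hS1 : ρ + 1 ≤ (insert z B \ coloops M G).card := by
    rw [card_insert_sdiff_coloops_thin hG hd' hB hz]; omega
  exact loss_eq_zero_of_unsat (hns _ hSsh hS1)

/-- A loss pair with positive weight is a hyperplane-basis member (no saturated middle target). -/
theorem card_sdiff_add_one_eq_of_rhoL_ne_zero_unsat {q ρ : ℕ} {G : Finset α} (hG : G ∈ flatsQ M (q + 1))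
    (hd' : (gr M \ G).card ≤ q) (hk : kColoops M G + ρ = q + 1)
    (hns : ∀ S ∈ shadowAt M (q + 2) q (Uq M (q + 2) q) G, ρ + 1 ≤ (S \ coloops M G).card →
      L1 M q G S ≤ capS M q G S)
    {B : Finset α} (hB : B ∈ thinMembers M q G) {z : α} (hz : z ∈ G \ clF M B)
    (hρ' : rhoL M q G B z ≠ 0) : (B \ coloops M G).card + 1 = ρ := by
  have hloss : loss M q G B z ≠ 0 := by
    intro h; apply hρ'; unfold rhoL; rw [h, zero_div]
  have hge := card_sdiff_coloops_thin_ge hG hd' hk hB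
  by_contra hne
  exact hloss (loss_eq_zero_of_card_ge_unsat hG hd' hns hB (by omega) hz)

open scoped Classical in
/-- **The loss mass of a target through its covering BASES, under «no saturated middle target»**: if no shadow set
`S` with `|S ∖ K| ≥ ρ + 1` is oversubscribed at layer 1 (`L1 S ≤ capS S`) and the face losses of every covering basis
`K ∪ T` sum to at most `E ≥ 0`, then `pi2Mass S ≤ #coverBases(S) · E/(2^{n−ρ} − 1)` — `pi2Mass_le_excess_indep` with
the bases-only hypotheses (`0 ≤ cPrimeDGP`, partial spread) replaced by the hypothesis itself. -/
theorem pi2Mass_le_excess_unsat {q d ρ : ℕ} {G : Finset α} (hG : G ∈ flatsQ M (q + 1)) (hd : (gr M \ G).card = d)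
    (hdq : d ≤ q) (hk : kColoops M G + ρ = q + 1)
    (hns : ∀ S ∈ shadowAt M (q + 2) q (Uq M (q + 2) q) G, ρ + 1 ≤ (S \ coloops M G).card →
      L1 M q G S ≤ capS M q G S)
    {E : ℚ} (S : Finset α)
    (hTE : ∀ T ∈ coverBases M G S ρ, ∑ w ∈ T, faceLoss M q G (coloops M G ∪ T) w ≤ E) :
    pi2Mass M q G S ≤
      ((coverBases M G S ρ).card : ℚ) * (E / ((2 ^ ((G.card - kColoops M G) - ρ) - 1 : ℕ) : ℚ)) := by
  have hd' : (gr M \ G).card ≤ q := by omega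
  rw [pi2Mass_eq_sum_lossPairsAt]
  set r := (G.card - kColoops M G) - ρ with hr
  set D : ℚ := ((2 ^ r - 1 : ℕ) : ℚ) with hD
  have hD0 : 0 ≤ D := by rw [hD]; positivity
  -- the pairs with zero weight contribute nothing
  set F := (lossPairsAt M q G S).filter (fun p => rhoL M q G p.1 p.2 ≠ 0) with hF
  have hsplit : ∑ p ∈ lossPairsAt M q G S, rhoL M q G p.1 p.2 = ∑ p ∈ F, rhoL M q G p.1 p.2 := by
    rw [hF, Finset.sum_filter]
    apply Finset.sum_congr rfl
    intro p _
    split_ifs with h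
    · rfl
    · push Not at h; rw [h]
  rw [hsplit]
  -- the grouping map and the face-loss weight
  set g : (Σ _T : Finset α, α) → ℚ := fun x => faceLoss M q G (coloops M G ∪ x.1) x.2 / D with hg
  set φ : Finset α × α → (Σ _T : Finset α, α) := fun p => ⟨insert p.2 (p.1 \ coloops M G), p.2⟩ with hφ
  -- facts about the members of F
  have hmem : ∀ p ∈ F, p.1 ∈ thinMembers M q G ∧ p.2 ∈ G \ clF M p.1 ∧ S ∈ tgtSets M q G p.1 p.2 ∧
      (p.1 \ coloops M G).card + 1 = ρ := by
    intro p hp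
    rw [hF, Finset.mem_filter] at hp
    obtain ⟨hp, hρ'⟩ := hp
    unfold lossPairsAt at hp
    rw [Finset.mem_filter, Finset.mem_image] at hp
    obtain ⟨⟨x, hx, rfl⟩, hpS⟩ := hp
    rw [Finset.mem_sigma] at hx
    obtain ⟨hB, hz⟩ := hx
    exact ⟨hB, hz, hpS, card_sdiff_add_one_eq_of_rhoL_ne_zero_unsat hG hd' hk hns hB hz hρ'⟩
  have hval : ∀ p ∈ F, rhoL M q G p.1 p.2 = g (φ p) := by
    intro p hp
    obtain ⟨hB, hz, -, h2⟩ := hmem p hp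
    have hB' : p.1 ∈ membersIn M (Uq M (q + 2) q) G := (mem_thinMembers.1 hB).1
    have hBU : p.1 ∈ Uq M (q + 2) q := (mem_membersIn.1 hB').1
    have hzB : p.2 ∉ p.1 := notMem_of_notMem_clF hBU (Finset.mem_sdiff.1 hz).2
    have hK : coloops M G ⊆ p.1 := coloops_subset_of_mem_thinMembers hG hd' hB
    have hQ : coloops M G ∪ insert p.2 (p.1 \ coloops M G) = insert p.2 p.1 := by
      ext x
      simp only [Finset.mem_union, Finset.mem_insert, Finset.mem_sdiff]
      constructor
      · rintro (h | h | ⟨h, -⟩)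
        · exact Or.inr (hK h)
        · exact Or.inl h
        · exact Or.inr h
      · rintro (h | h)
        · exact Or.inr (Or.inl h)
        · by_cases hx : x ∈ coloops M G
          · exact Or.inl hx
          · exact Or.inr (Or.inr ⟨h, hx⟩)
    simp only [hg, hφ]
    rw [hQ]
    unfold rhoL faceLoss
    rw [Finset.erase_insert hzB, if_pos ⟨hB, hz⟩, card_tgtSets hG hB' hz,
      card_sdiff_insert_eq_dqm1 hG hd' hB h2 hz, ← hr]
  have hinj : Set.InjOn φ (F : Set (Finset α × α)) := by
    intro p hp p' hp' heq
    obtain ⟨hB, hz, -, -⟩ := hmem p hp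
    obtain ⟨hB', hz', -, -⟩ := hmem p' hp'
    simp only [hφ, Sigma.mk.injEq] at heq
    obtain ⟨hT, hzz⟩ := heq
    have hzz' : p.2 = p'.2 := eq_of_heq hzz
    have hBU : p.1 ∈ Uq M (q + 2) q := (mem_membersIn.1 (mem_thinMembers.1 hB).1).1
    have hBU' : p'.1 ∈ Uq M (q + 2) q := (mem_membersIn.1 (mem_thinMembers.1 hB').1).1
    have hBB := lossPairs_inj hG hd' hB hB' hT hzz'
      (notMem_of_notMem_clF hBU (Finset.mem_sdiff.1 hz).2)
      (notMem_of_notMem_clF hBU' (Finset.mem_sdiff.1 hz').2)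
    exact Prod.ext hBB hzz'
  have himg : Finset.image φ F ⊆ (coverBases M G S ρ).sigma (fun T => T) := by
    intro x hx
    rw [Finset.mem_image] at hx
    obtain ⟨p, hp, rfl⟩ := hx
    obtain ⟨hB, hz, hpS, h2⟩ := hmem p hp
    have hB' : p.1 ∈ membersIn M (Uq M (q + 2) q) G := (mem_thinMembers.1 hB).1
    have hBU : p.1 ∈ Uq M (q + 2) q := (mem_membersIn.1 hB').1
    have hzB : p.2 ∉ p.1 := notMem_of_notMem_clF hBU (Finset.mem_sdiff.1 hz).2
    have hzK : p.2 ∉ p.1 \ coloops M G := fun hh => hzB (Finset.mem_sdiff.1 hh).1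
    have hsub : insert p.2 p.1 ⊆ S := (mem_tgtSets.1 hpS).2.1
    have hK : coloops M G ⊆ p.1 := coloops_subset_of_mem_thinMembers hG hd' hB
    have hQ : coloops M G ∪ insert p.2 (p.1 \ coloops M G) = insert p.2 p.1 := by
      ext y
      simp only [Finset.mem_union, Finset.mem_insert, Finset.mem_sdiff]
      constructor
      · rintro (h | h | ⟨h, -⟩)
        · exact Or.inr (hK h)
        · exact Or.inl h
        · exact Or.inr h
      · rintro (h | h)
        · exact Or.inr (Or.inl h)
        · by_cases hy : y ∈ coloops M G
          · exact Or.inl hy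
          · exact Or.inr (Or.inr ⟨h, hy⟩)
    have hcard : (insert p.2 p.1 \ coloops M G).card = ρ := by
      have : insert p.2 p.1 \ coloops M G = insert p.2 (p.1 \ coloops M G) := by
        ext y
        simp only [Finset.mem_sdiff, Finset.mem_insert]
        constructor
        · rintro ⟨h | h, hy⟩
          · exact Or.inl h
          · exact Or.inr ⟨h, hy⟩
        · rintro (rfl | ⟨h, hy⟩)
          · exact ⟨Or.inl rfl, fun hc => hzB (hK hc)⟩
          · exact ⟨Or.inr h, hy⟩
      rw [this, Finset.card_insert_of_notMem hzK, h2]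
    have hind : M.Indep ((coloops M G ∪ insert p.2 (p.1 \ coloops M G) : Finset α) : Set α) := by
      rw [hQ]
      exact indep_of_mem_shadowAt_card hk (insert_mem_shadowAt_thin hG hB hz) hcard
    rw [Finset.mem_sigma]
    refine ⟨?_, Finset.mem_insert_self _ _⟩
    unfold coverBases
    rw [Finset.mem_filter, Finset.mem_powersetCard]
    refine ⟨⟨?_, ?_⟩, hind⟩
    · intro y hy
      rw [Finset.mem_insert] at hy
      rw [Finset.mem_sdiff]
      rcases hy with rfl | hy
      · refine ⟨hsub (Finset.mem_insert_self _ _), ?_⟩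
        intro hzc
        exact hzB (hK hzc)
      · rw [Finset.mem_sdiff] at hy
        exact ⟨hsub (Finset.mem_insert_of_mem hy.1), hy.2⟩
    · rw [Finset.card_insert_of_notMem hzK, h2]
  have hg0 : ∀ x, 0 ≤ g x := fun x => div_nonneg (faceLoss_nonneg hG hd' _ _) hD0
  calc ∑ p ∈ F, rhoL M q G p.1 p.2 = ∑ p ∈ F, g (φ p) := Finset.sum_congr rfl hval
    _ = ∑ x ∈ Finset.image φ F, g x := (Finset.sum_image hinj).symm
    _ ≤ ∑ x ∈ (coverBases M G S ρ).sigma (fun T => T), g x :=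
        Finset.sum_le_sum_of_subset_of_nonneg himg (fun x _ _ => hg0 x)
    _ = ∑ T ∈ coverBases M G S ρ, (∑ w ∈ T, faceLoss M q G (coloops M G ∪ T) w) / D := by
        rw [Finset.sum_sigma]
        apply Finset.sum_congr rfl
        intro T _
        rw [Finset.sum_div]
    _ ≤ ∑ _T ∈ coverBases M G S ρ, E / D := by
        apply Finset.sum_le_sum
        intro T hT
        exact div_le_div_of_nonneg_right (hTE T hT) hD0
    _ = ((coverBases M G S ρ).card : ℚ) * (E / D) := by
        rw [Finset.sum_const, nsmul_eq_mul]

open scoped Classical in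
/-- **THE ASSEMBLY WITH A COUNT OF THE COVERING BASES UNDER «NO SATURATED MIDDLE TARGET»**: if no shadow set with
`|S ∖ K| ≥ ρ + 1` is oversubscribed at layer 1, every such set keeps the residual capacity `c″ ≥ 0`, the face losses of
every covering basis sum to at most `E > 0` and every target `S ⊆ G` has at most `cnt |S ∖ K|` covering bases
(`cnt > 0` on `[ρ + 1, n]`), then (LI_G) holds as soon as `countSum n ρ (q − d + 1) c″ E cnt ≥ 1` at `n = |G ∖ K|`.
This is `localShadowHall_excess_of_count` without the bases-only hypotheses (the sign of `cPrimeDGP`, partial spread),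
which were used only to make the big thin members lossless and to bound the middle capacity. -/
theorem localShadowHall_excess_of_count_unsat {q d ρ : ℕ} {G : Finset α} (hG : G ∈ flatsQ M (q + 1))
    (hd : (gr M \ G).card = d) (hdq : d ≤ q) (hk : kColoops M G + ρ = q + 1) (hρ : 3 ≤ ρ)
    (hns : ∀ S ∈ shadowAt M (q + 2) q (Uq M (q + 2) q) G, ρ + 1 ≤ (S \ coloops M G).card →
      L1 M q G S ≤ capS M q G S)
    {c'' : ℚ} (hc'' : 0 ≤ c'')
    (hcap : ∀ S ∈ shadowAt M (q + 2) q (Uq M (q + 2) q) G, ρ + 1 ≤ (S \ coloops M G).card →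
      c'' ≤ cap2 M q G S)
    {E : ℚ} (hE : 0 < E)
    (hTE : ∀ S : Finset α, S ⊆ G → ∀ T ∈ coverBases M G S ρ,
      ∑ w ∈ T, faceLoss M q G (coloops M G ∪ T) w ≤ E)
    {cnt : ℕ → ℚ} (hcpos : ∀ s, ρ + 1 ≤ s → s ≤ G.card - kColoops M G → 0 < cnt s)
    (hcnt : ∀ S : Finset α, S ⊆ G → ((coverBases M G S ρ).card : ℚ) ≤ cnt (S \ coloops M G).card)
    (hsum : 1 ≤ countSum (G.card - kColoops M G) ρ (q - d + 1) c'' E cnt) :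
    LocalShadowHall M q G := by
  have hd' : (gr M \ G).card ≤ q := by omega
  have hKG : coloops M G ⊆ G := fun y hy => (mem_coloops.1 hy).1
  apply localShadowHall_of_lossFair hG hd'
  intro B hB z hz
  by_cases hl0 : loss M q G B z = 0
  · rw [hl0]
    exact mul_nonneg (rhoL_nonneg hG hd' B z) (lossIncome_nonneg hG hd' B z)
  have hB' : B ∈ membersIn M (Uq M (q + 2) q) G := (mem_thinMembers.1 hB).1
  have hBU : B ∈ Uq M (q + 2) q := (mem_membersIn.1 hB').1
  have hzB : z ∉ B := notMem_of_notMem_clF hBU (Finset.mem_sdiff.1 hz).2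
  have hK := coloops_subset_of_mem_thinMembers hG hd' hB
  have h2 : (B \ coloops M G).card + 1 = ρ := by
    by_contra hne
    have hge := card_sdiff_coloops_thin_ge hG hd' hk hB
    exact hl0 (loss_eq_zero_of_card_ge_unsat hG hd' hns hB (by omega) hz)
  set n := G.card - kColoops M G with hn
  have hr : (G \ insert z B).card = n - ρ := card_sdiff_insert_eq_dqm1 hG hd' hB h2 hz
  have hr1 : 1 ≤ n - ρ := by rw [← hr]; exact one_le_card_sdiff_insert hG hd' hB hz
  have hBcard : B.card = kColoops M G + (B \ coloops M G).card := by
    rw [kColoops_eq_card_coloops, ← Finset.card_union_of_disjoint Finset.disjoint_sdiff,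
      Finset.union_sdiff_of_subset hK]
  have hb' : (insert z B).card = q + 1 := by rw [Finset.card_insert_of_notMem hzB, hBcard]; omega
  have hT : (tgtSets M q G B z).card = 2 ^ (n - ρ) - 1 := by rw [card_tgtSets hG hB' hz, hr]
  have hTpos : (0 : ℚ) < ((2 ^ (n - ρ) - 1 : ℕ) : ℚ) := by
    have : 2 ≤ 2 ^ (n - ρ) := by
      calc 2 = 2 ^ 1 := by norm_num
        _ ≤ 2 ^ (n - ρ) := Nat.pow_le_pow_right (by norm_num) hr1
    exact_mod_cast (by omega : 0 < 2 ^ (n - ρ) - 1)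
  have hGcard : G.card = n + kColoops M G := by
    have : kColoops M G ≤ G.card := by
      rw [kColoops_eq_card_coloops]
      exact Finset.card_le_card hKG
    omega
  set u : ℕ → ℚ := fun s => cnt (s - kColoops M G) * (E / ((2 ^ (n - ρ) - 1 : ℕ) : ℚ)) with hu_def
  set v : ℕ → ℚ := fun s => if s + (q - d + 1) ≤ G.card then c'' else 1 with hv_def
  have hKS : ∀ S ∈ tgtSets M q G B z, coloops M G ⊆ S :=
    fun S hS => coloops_subset_of_mem_shadowAt (mem_tgtSets.1 hS).1
  have hSK : ∀ S ∈ tgtSets M q G B z, (S \ coloops M G).card = S.card - kColoops M G := by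
    intro S hS
    rw [Finset.card_sdiff_of_subset (hKS S hS), kColoops_eq_card_coloops]
  have hρ1 : ∀ S ∈ tgtSets M q G B z, ρ + 1 ≤ (S \ coloops M G).card := by
    intro S hS
    obtain ⟨-, hBS, hcard⟩ := mem_tgtSets.1 hS
    have hBS' : B ⊆ S := (Finset.subset_insert z B).trans hBS
    have hsub : (S \ B) ∪ (B \ coloops M G) ⊆ S \ coloops M G := by
      intro x hx
      rw [Finset.mem_union, Finset.mem_sdiff, Finset.mem_sdiff] at hx
      rw [Finset.mem_sdiff]
      rcases hx with ⟨hxS, hxB⟩ | ⟨hxB, hxK⟩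
      · exact ⟨hxS, fun h => hxB (hK h)⟩
      · exact ⟨hBS' hxB, hxK⟩
    have hdisj : Disjoint (S \ B) (B \ coloops M G) := by
      rw [Finset.disjoint_left]; intro x hx hx'
      exact (Finset.mem_sdiff.1 hx).2 (Finset.mem_sdiff.1 hx').1
    have := Finset.card_le_card hsub
    rw [Finset.card_union_of_disjoint hdisj] at this
    omega
  have hρ0 : (0 : ℚ) < (ρ : ℚ) := by exact_mod_cast (by omega : 0 < ρ)
  have hu : ∀ S ∈ tgtSets M q G B z, pi2Mass M q G S ≤ u S.card := by
    intro S hS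
    have hSG : S ⊆ G := subset_G_of_mem_shadowAt (mem_tgtSets.1 hS).1
    have hmass := pi2Mass_le_excess_unsat hG hd hdq hk hns S (hTE S hSG)
    have hcntS := hcnt S hSG
    rw [hSK S hS] at hcntS
    have hED : 0 ≤ E / ((2 ^ (n - ρ) - 1 : ℕ) : ℚ) := div_nonneg hE.le hTpos.le
    simp only [hu_def]
    calc pi2Mass M q G S ≤ ((coverBases M G S ρ).card : ℚ) * (E / ((2 ^ (n - ρ) - 1 : ℕ) : ℚ)) := hmass
      _ ≤ cnt (S.card - kColoops M G) * (E / ((2 ^ (n - ρ) - 1 : ℕ) : ℚ)) :=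
          mul_le_mul_of_nonneg_right hcntS hED
  have hv : ∀ S ∈ tgtSets M q G B z, v S.card ≤ cap2 M q G S := by
    intro S hS
    have hS' := (mem_tgtSets.1 hS).1
    have hSG : S ⊆ G := subset_G_of_mem_shadowAt hS'
    simp only [hv_def]
    split_ifs with hle
    · exact hcap S hS' (hρ1 S hS)
    · push Not at hle
      have h1 : (G \ S).card ≤ q - d := by
        rw [Finset.card_sdiff_of_subset hSG]; omega
      exact (cap2_eq_one_of_card_le hG (by rw [hd]; omega)).ge
  have hv0 : ∀ S ∈ tgtSets M q G B z, 0 ≤ v S.card := by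
    intro S _
    simp only [hv_def]
    split_ifs
    · exact hc''
    · exact zero_le_one
  have hinc := lossIncome_ge_of_bounds hG hd' hB hz hl0 u v hu hv hv0
  rw [hr, hb'] at hinc
  have hsum' : ∑ j ∈ Finset.Icc 1 (n - ρ), ((n - ρ).choose j : ℚ) * (v (q + 1 + j) / u (q + 1 + j)) =
      ((2 ^ (n - ρ) - 1 : ℕ) : ℚ) * countSum n ρ (q - d + 1) c'' E cnt := by
    unfold countSum
    rw [Finset.mul_sum]
    apply Finset.sum_congr rfl
    intro j hj
    rw [Finset.mem_Icc] at hj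
    have hv' : v (q + 1 + j) = DGenP.cjG n ρ (q - d + 1) j c'' := by
      simp only [hv_def, DGenP.cjG]
      have hiff : q + 1 + j + (q - d + 1) ≤ G.card ↔ j + ρ + (q - d + 1) ≤ n := by omega
      by_cases hcj : j + ρ + (q - d + 1) ≤ n
      · rw [if_pos (hiff.2 hcj), if_pos hcj]
      · rw [if_neg (fun h => hcj (hiff.1 h)), if_neg hcj]
    have hu' : u (q + 1 + j) = cnt (j + ρ) * (E / ((2 ^ (n - ρ) - 1 : ℕ) : ℚ)) := by
      simp only [hu_def]
      rw [show q + 1 + j - kColoops M G = j + ρ by omega]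
    rw [hv', hu']
    have hjρ : (0 : ℚ) < cnt (j + ρ) := hcpos (j + ρ) (by omega) (by omega)
    field_simp
  rw [hsum'] at hinc
  unfold rhoL
  rw [hT]
  have hl' : 0 < loss M q G B z := lt_of_le_of_ne (loss_nonneg' hG hd' B z) (Ne.symm hl0)
  calc loss M q G B z = loss M q G B z / ((2 ^ (n - ρ) - 1 : ℕ) : ℚ) * ((2 ^ (n - ρ) - 1 : ℕ) : ℚ) := by
        field_simp
    _ ≤ loss M q G B z / ((2 ^ (n - ρ) - 1 : ℕ) : ℚ) *
          (((2 ^ (n - ρ) - 1 : ℕ) : ℚ) * countSum n ρ (q - d + 1) c'' E cnt) := by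
        apply mul_le_mul_of_nonneg_left _ (div_nonneg hl'.le hTpos.le)
        nlinarith [hsum, hTpos]
    _ ≤ loss M q G B z / ((2 ^ (n - ρ) - 1 : ℕ) : ℚ) * lossIncome M q G B z :=
        mul_le_mul_of_nonneg_left hinc (div_nonneg hl'.le hTpos.le)

end PercRepro.Shadow
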